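import Summits.QuantumFields.YangMills.Theorems.BalabanUVNodesK0TwoPrimeOfFixedRadiusBox
import Summits.QuantumFields.YangMills.Theorems.BalabanUVNodesN09HierarchyBindersOfLevelwiseThm1
import Summits.QuantumFields.YangMills.Theorems.BalabanUVNodesN09FlatSectorUniqueness

/-!
# K0⁷ — THE №432 DOOR «2′ ⟸ box at ONE radius ā + rows» WITH ITS [15]-ROWS AT THE FIXED RADIUS IN N07's STANDARD SLOT CURRENCY (`hT1` ∕ `hUk` ∕ `h11`)

Cell `pub-ymgap`, width seat `pub-ymgap-dag-n07-w3` (g20; N07 [B11] ∕ K0⁷ junction).  `--kind proof --supports stmt-QuantumFields-20541 --as helper`, COUNT-NEUTRAL.  NEW leaf;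
theorems only — 0 `def`, 0 `sorry`, 0 `instance`, 0 `notation`.  Imports this seat's g19 door `…K0TwoPrimeOfFixedRadiusBox` (✓p789666; it carries `…K0Beta13RadiusBlindFirstForm`
✓p788772 and `…K0V23Defs`), dag-n09-w1's `…N09HierarchyBindersOfLevelwiseThm1` (the ORDER-THEORETIC restriction lemma `isBackground_restrict_of_minimiser_mem`; it carries dag-n21-c's
`…N21AveragedDatumRegularity.plaqSmall_iter_avOfRecord_level` = [B7] (53) at NODE 00's averaging and `…N21RegularityTransferJunction.plaqSmall_Uk_of_thm1_objects` = the (8)→(9) transfer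
from Theorem 1 AT OBJECTS) and dag-n09-w1's `…N09FlatSectorUniqueness` (the flat sector).  [I] = [Balaban1987RG1]; [15] = [Balaban1985Variational]; [B7] = [Balaban1985Averaging].

WHY.  g19's door `K0TwoPrimeOfFixedRadiusBox.absBetaBoxGZBAt_of_boxAtRadius_of_firstFormRows` (director-ym №432's node «2′ ⟸ (W₁) ∧ (T) two-sided» in kernel form) displays, at the ONE
background radius `ā`, five rows of [15]∕N07 species on the first-form domain system `U` of regularity `ρ`: (hU1) `1 ∈ U`; (hsub)∕(hsup) `U` IS the first form; (hR) RESTRICTION — `U_{k+1}(ā; W)`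
minimises the level-`k` problem at its own `k`-fold average ([I] (1.1), [15] (9)–(10)); (hQ) uniqueness of the level-`k` minimal orbit there; (hS) the Lipschitz-(8) collar row.  N09's doors of
record (dag-n09-w2∕w3, dag-n24-c's `h09T` children) read [15] through THREE standard slots only (dag-n09-w1 `…N09HierarchyBindersOfLevelwiseThm1.hres_huniq_hreg8_of_thm1Objects_of_ukRows_of_h11`):
`hT1` = Theorem 1 AT OBJECTS per member (dag-n07-a's `B11Thm1CarrierT.objects_of_thm1Printed` body, VERBATIM), `hUk` = NODE 00's ₈a rows, `h11` = level-wise existence ∧ uniqueness of the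
minimal orbit on a plaquette domain.  THIS FILE re-keys the door to that currency: (hU1) is DISCHARGED (flat sector), (hR) and (hQ) are DERIVED from `hT1`∕`hUk`∕`h11` + numerics on the
producer's letter `ρ`, and the door is re-issued as ★★ `absBetaBoxGZBAt_of_boxAtRadius_of_thm1Slots`.  After it the K0 radius-collapse door and the N09 doors consume THE SAME N07 input;
what stays displayed of [15] is exactly the §F species (openness of the first form, the Lipschitz collar (hS)) + the row-P7 continuity (hT) + the selector's upward (8)-row — and NODE O's box.

MECHANISM (§2, generic rank `N`; this seat's g19 LOCATED-2 ∕ ERRATUM E-n07w3-g19-1 respected: NO per-level compounding).  Fix `K`, `k`, `W ∈ U_{K,k+1}`: the radius-`ā` problem at `W` is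
solvable and its minimiser of record `U₀ := U_{k+1}(ā; W)` is `ρ·η_{k+1}²`-regular (first form).  (53) at NODE 00's averaging (`plaqSmall_iter_avOfRecord_level`, level `k+1`, `j = k`):
the datum `V := Ū^k(U₀)` is `2ρ(L^kη_{k+1})² = 2ρ∕L²`-plaquette-small.  `h11` at `V` (domain `PlaqSmall δ₁₁ ⊇ PlaqSmall(2ρ∕L²)`): (hQ), and the level-`k` problem at `V` is solvable.
`hT1` + `hUk` (dag-n21-c's transfer at `δ := 2ρ∕L²`, `B·δ ≤ ā ≤ α₀`, `δ ≤ α₁`): the level-`k` minimiser of record `U₁ := U_k(ā; V)` is `B·(2ρ∕L²)·η_k²`-regular, i.e. lies in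
`bgReg_{k+1}(ā) = PlaqSmall(ā·η_k²∕L²)` as soon as `2Bρ ≤ ā` — a FIXED fraction of `ā`, paid ONCE per level against the SAME `ρ` (the first form regenerates `ρ` one level up through
(hR)+(hQ), g19's `…RadiusBlindFirstForm` §3; nothing compounds).  Then dag-n09-w1's ORDER THEORY (`isBackground_restrict_of_minimiser_mem`, `reg₁ = bgReg_{k+1}(ā) ⊆ reg₂ = bgReg_k(ā)`,
`U₁ ∈ reg₁`): `U₀` minimises the level-`k` problem at `V` within `bgReg_k(ā)` — (hR), UNIQUENESS-FREE.  (hU1): the flat datum's radius-`ā` minimisers are plaquette-flat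
(`flat_of_isBackground_of_flat`), hence `ρ·η_k²`-regular for every `ρ > 0`.

CONTENTS.  §1 letter bookkeeping (`d = 4`, `η_{k+1} = η_k∕L`; the (53) numerics pair in `K`-free letters).  §2 ★ `isBackground_restrict_and_uniqueUkOrbit_of_slots` (generic `N`),
`one_mem_firstForm`, `slotNumerics_inhabited` (A6: the `ρ`-numerics are an inhabited range for every `ā, δ₁₁, α₁ > 0`, `B ≥ 0`).  §3 ★★ `absBetaBoxGZBAt_of_boxAtRadius_of_thm1Slots` (`N = 2`):
g19's door with `hT1`∕`hUk`∕`h11` at door level and, per text radius `a₀`, the producer's package «numerics on `ρ` + box at `ā` + `IsOpen U` + first-form sandwich + collar + continuity +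
selector alternative» — composed BY NAME with `absBetaBoxGZBAt_of_boxAtRadius_of_firstFormRows`.

HONEST FRAMING (binding).  A by-name composition; NO β estimate; nothing of Bałaban's asserted.  DISPLAYED and their species: `hT1` (Theorem 1 at objects, [15] Thm 1 (6),(8) p. 279 — levels
`k ≥ 1` are Bałaban's theorem, proved NOWHERE in the tree; INHABITED at every member `(K, 0)` by dag-n21-c's `thm1_objects_levelZero'`), `hUk` (₈a rows at radius `ā`; `(K, 0)`: `ukRows_levelZero`),
`h11` ([I] (1.1) on `PlaqSmall δ₁₁`; inhabited on the flat sector, dag-n09-w1 `h11_of_flat_iter`), the box at `ā` (NODE O's wall: [I] Thm 3 β-clause p. 264 — print-proved (claimed), UNPORTED),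
`IsOpen U` and the collar row (hS) ([15] §F species, NOT in the tree), (hT) (row-P7 continuity at ONE radius), the selector's upward (8)-row; numerics.  None is discharged here.  Stub 2′ OPEN;
K0⁷ stmt-QuantumFields-20541 NOT closed; N07 NOT discharged; COUNT 8∕28 · K 1∕4 UNMOVED; R4 = the CONDITIONAL finite-𝕋⁴ rung `BalabanLadder.UV` at fixed `ε = L^(−K)` only — NOT continuum ∕
ℝ⁴ ∕ OS; the Yang–Mills mass gap (Clay) is NOT proved by any of this.  Standard axioms only.
-/

noncomputable section

open MeasureTheory Set Filter
open scoped Matrix.Norms.L2Operator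

namespace Summit.QuantumFields.YangMills.BalabanUVNodes.K0TwoPrimeOfFixedRadiusBoxThm1Slots

open Literature.MathematicalPhysics.QuantumFieldTheory.Balaban1983to89
open Literature.MathematicalPhysics.QuantumFieldTheory.Balaban1983to89.Node00
open Literature.MathematicalPhysics.QuantumFieldTheory.Balaban1983to89.T4Continuum
open Literature.MathematicalPhysics.QuantumFieldTheory.Balaban1983to89.FlowStep
open Literature.MathematicalPhysics.QuantumFieldTheory.Balaban1983to89.B15DeterminingSets
open Literature.MathematicalPhysics.QuantumFieldTheory.Balaban1983to89.ExpMeanLog (deltaSU deltaSU_pos)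
open Literature.MathematicalPhysics.QuantumFieldTheory.Balaban1983to89.B12GaugeOrbits021 (OrbitRel)
open B12Eq019ActionBody (integrand)
open Summit.QuantumFields.YangMills.Theorems.K0V23Defs (AbsBetaBoxAtThm1WitnessCCMGenGridGZBAt)
open Summit.QuantumFields.YangMills.BalabanUVNodes.K0TwoPrimeOfFixedRadiusBox (absBetaBoxGZBAt_of_boxAtRadius_of_firstFormRows)
open Summit.QuantumFields.YangMills.BalabanUVNodes.K0Beta13RadiusBlindFirstForm (bgReg_succ_subset)
open Summit.QuantumFields.YangMills.BalabanUVNodes.N09HierarchyBindersOfLevelwiseThm1 (isBackground_restrict_of_minimiser_mem)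
open Summit.QuantumFields.YangMills.Theorems.N21AveragedDatumRegularity (plaqSmall_iter_avOfRecord_level)
open Summit.QuantumFields.YangMills.Theorems.N21RegularityTransferJunction (plaqSmall_Uk_of_thm1_objects)
open Summit.QuantumFields.YangMills.BalabanUVNodes.N09FlatSectorUniqueness (flat_one flat_of_isBackground_of_flat mem_bgReg_of_flat ukExists_of_flat_iter)
open Summit.QuantumFields.YangMills.BalabanUVNodes.N07Prop8StepFlatWitness (iter_avOfRecord_one)

/-! ## §1  Letter bookkeeping: `d = 4`, `η_{k+1} = η_k ∕ L`, the (53) numerics pair in `K`-free letters -/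

section Letters

variable {F : T4Family} {N : ℕ} [NeZero N]

omit [NeZero N] in
/-- `d + 4 = 8` at the record (`d = 4`). [cite: Balaban1987RG1, (0.1) p.251 (bookkeeping)] -/
theorem cast_d_add_four (K : ℕ) : ((((F.P K).d + 4 : ℕ) : ℝ)) = 8 := by
  rw [T4Family.P_d]; norm_num

omit [NeZero N] in
/-- `(d + 4)·L = 8L` at the record. [cite: Balaban1987RG1, (0.1) p.251 (bookkeeping)] -/
theorem cast_d_add_four_mul_L (K : ℕ) : ((((F.P K).d + 4) * (F.P K).L : ℕ) : ℝ) = 8 * (F.L : ℝ) := by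
  rw [T4Family.P_d, T4Family.P_L]; push_cast; ring

omit [NeZero N] in
/-- The first (53) side condition `C₀(d)·ρ ≤ ⅓` at `d = 4` reads `143·256·ρ ≤ ⅓` (`((d+4)²∕4)² = 256`). [cite: Balaban1985Averaging, Prop. 2 (52)–(53) p.26 (bookkeeping)] -/
theorem h53a_at (K : ℕ) {ρ : ℝ} (h : 143 * 256 * ρ ≤ 1 / 3) :
    (143 * (((((F.P K).d + 4 : ℕ) : ℝ)) ^ 2 / 4) ^ 2) * ρ ≤ 1 / 3 := by
  rw [cast_d_add_four]
  have h256 : (143 * (((8 : ℝ)) ^ 2 / 4) ^ 2) = 143 * 256 := by norm_num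
  rw [h256]
  exact h

omit [NeZero N] in
/-- The second (53) side condition `2ρ ≤ c′₂ = 2δ_{SU(N)}∕((d+4)L)²` at `d = 4`. [cite: Balaban1985Averaging, Prop. 2 (52)–(53) p.26 (bookkeeping)] -/
theorem h53b_at (K : ℕ) {ρ : ℝ} (h : 2 * ρ ≤ 2 * deltaSU (Fin N) / (8 * (F.L : ℝ)) ^ 2) :
    2 * ρ ≤ 2 * deltaSU (Fin N) / ((((F.P K).d + 4) * (F.P K).L : ℕ) : ℝ) ^ 2 := by
  rw [cast_d_add_four_mul_L]
  exact h

omit [NeZero N] in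
/-- `L^k · η_{k+1} = 1∕L` (`η_j = L^{−j}`). [cite: Balaban1987RG1, (1.1)–(1.2) p.260 (bookkeeping)] -/
theorem pow_mul_eta_succ (K k : ℕ) : ((F.P K).L : ℝ) ^ k * (F.P K).eta (k + 1) = ((F.L : ℝ))⁻¹ := by
  have hL : ((F.P K).L : ℝ) ≠ 0 := by exact_mod_cast (F.P K).L_pos.ne'
  rw [Params.eta, pow_succ, ← mul_assoc, ← mul_pow, mul_inv_cancel₀ hL, one_pow, one_mul, T4Family.P_L]

omit [NeZero N] in
/-- `η_{k+1}² = η_k² ∕ L²`. [cite: Balaban1987RG1, (1.2) p.260 (bookkeeping)] -/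
theorem eta_succ_sq (K k : ℕ) : (F.P K).eta (k + 1) ^ 2 = (F.P K).eta k ^ 2 / (F.L : ℝ) ^ 2 := by
  simp only [Params.eta, T4Family.P_L]
  rw [div_eq_mul_inv, ← inv_pow, ← mul_pow, ← pow_succ]

/-- **(53) ONE LEVEL DOWN**: a `ρ·η_{k+1}²`-regular fine field has a `2ρ∕L²`-plaquette-small `k`-fold average of record (dag-n21-c's `plaqSmall_iter_avOfRecord_level` at level `k+1`,
`j = k`, with `(L^kη_{k+1})² = 1∕L²`).  Numerics: `0 < ρ`, `143·256·ρ ≤ ⅓`, `2ρ ≤ 2δ_{SU(N)}∕(8L)²`. [cite: Balaban1985Averaging, Prop. 2 (53) p.26; Balaban1987RG1, (1.2) p.260] -/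
theorem plaqSmall_iter_of_mem_bgReg_succ (K k : ℕ) {ρ : ℝ} (hρ : 0 < ρ) (h53a : 143 * 256 * ρ ≤ 1 / 3)
    (h53b : 2 * ρ ≤ 2 * deltaSU (Fin N) / (8 * (F.L : ℝ)) ^ 2) {U : GaugeField (F.P K) 0 (SU N)} (hU : U ∈ bgReg F N K (k + 1) ρ) :
    PlaqSmall (2 * ρ / (F.L : ℝ) ^ 2) (Averaging.iter (avOfRecord F N K) k U) := by
  have h := plaqSmall_iter_avOfRecord_level K (k + 1) hρ (h53a_at K h53a) (h53b_at K h53b) ((mem_bgReg_iff F N K (k + 1) ρ U).1 hU) (Nat.le_succ k)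
  rw [pow_mul_eta_succ] at h
  have hδ : 2 * ρ * ((F.L : ℝ)⁻¹) ^ 2 = 2 * ρ / (F.L : ℝ) ^ 2 := by rw [inv_pow, div_eq_mul_inv]
  rw [hδ] at h
  exact h

end Letters

/-! ## §2  The door's rows (hU1), (hR), (hQ) from the flat sector and from the slots `hT1` ∕ `hUk` ∕ `h11` -/

section Rows

variable {F : T4Family} {N : ℕ} [NeZero N]

/-- **(hU1) DISCHARGED — THE FLAT DATUM IS IN EVERY FIRST FORM**: at `V = 1` the radius-`a` problem is solvable (the flat representative minimises, `A = 0`) and every radius-`a` minimiser over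
`V = 1` is plaquette-FLAT (`A(U₁) ≤ A(1) = 0`), hence `ρ·η_k²`-regular — for all `a, ρ > 0`. [cite: Balaban1985Variational, Thm 1 p.279 and (4) p.278; Balaban1987RG1, (0.21) p.256, (1.2) p.260] -/
theorem one_mem_firstForm (K k : ℕ) {a ρ : ℝ} (ha : 0 < a) (hρ : 0 < ρ) :
    UkExists F N K k a (1 : GaugeField (F.P K) k (SU N)) ∧
      ∀ U₁, IsBackground (avOfRecord F N K) (bgReg F N K k a) k (1 : GaugeField (F.P K) k (SU N)) U₁ → U₁ ∈ bgReg F N K k ρ := by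
  have hflat : ∀ p, GaugeField.plaqHol (1 : GaugeField (F.P K) 0 (SU N)) p = 1 := flat_one
  refine ⟨?_, fun U₁ h₁ => ?_⟩
  · have h := ukExists_of_flat_iter (F := F) (N := N) (K := K) k ha hflat
    rwa [iter_avOfRecord_one] at h
  · rw [← iter_avOfRecord_one F N K k] at h₁
    exact mem_bgReg_of_flat (flat_of_isBackground_of_flat hflat h₁) k hρ

/-- ★ **(hR) RESTRICTION AND (hQ) UNIQUENESS AT THE AVERAGED DATUM FROM THE THREE STANDARD [B11] SLOTS** — member `(K, k)`, radius `a`, regularity `ρ`.  Slots: `hT1` (Theorem 1 AT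
OBJECTS for the member `(K, k)`, dag-n07-a's `objects_of_thm1Printed` body VERBATIM, ceilings `α₀ α₁`, constant `B`), `hUk` (₈a's rows at radius `a`), `h11` (level-`k` existence ∧ uniqueness of
the minimal orbit on `PlaqSmall δ₁₁`).  Numerics: `0 < a ≤ α₀`, `0 < ρ`, the (53) pair, `2ρ ≤ δ₁₁L²`, `2ρ ≤ α₁L²`, `0 ≤ B`, `2Bρ ≤ a`.  For `W` at which the radius-`a` problem at level `k+1`
is solvable with every minimiser `ρ·η_{k+1}²`-regular: `U_{k+1}(a; W)` minimises the level-`k` problem at `Ū^k(U_{k+1}(a; W))` within `bgReg_k(a)` (ORDER THEORY, dag-n09-w1's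
`isBackground_restrict_of_minimiser_mem` with `U₁ := U_k(a; Ū^k U_{k+1}(a;W)) ∈ bgReg_{k+1}(a)` by (53) + the (8)→(9) transfer) AND the level-`k` minimal orbit there is unique (`h11`).
CONDITIONAL on the slots; nothing of Bałaban's asserted. [cite: Balaban1985Variational, Thm 1 (6),(8)–(10) p.279; Balaban1987RG1, (1.1)–(1.2) p.260, (0.21) p.256; Balaban1985Averaging, Prop. 2 (53) p.26] -/
theorem isBackground_restrict_and_uniqueUkOrbit_of_slots (K k : ℕ) {a ρ δ₁₁ α₀ α₁ B : ℝ} (ha : 0 < a) (haα : a ≤ α₀) (hρ : 0 < ρ)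
    (h53a : 143 * 256 * ρ ≤ 1 / 3) (h53b : 2 * ρ ≤ 2 * deltaSU (Fin N) / (8 * (F.L : ℝ)) ^ 2)
    (hδ : 2 * ρ ≤ δ₁₁ * (F.L : ℝ) ^ 2) (hα₁ : 2 * ρ ≤ α₁ * (F.L : ℝ) ^ 2) (hB : 0 ≤ B) (hBρ : 2 * B * ρ ≤ a)
    (hT1 : ∀ ε₁ : ℝ, 0 < ε₁ → ε₁ ≤ α₁ → ∀ V : GaugeField (F.P K) k (SU N), PlaqSmall ε₁ V →
      (∃ U : GaugeField (F.P K) 0 (SU N), IsBackground (avOfRecord F N K) {U | InUkClassB11 F N K k (B * ε₁) U} k V U) ∧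
      (∀ ε₀ : ℝ, B * ε₁ ≤ ε₀ → ε₀ ≤ α₀ → ∀ U U' : GaugeField (F.P K) 0 (SU N),
          IsBackground (avOfRecord F N K) {U | InUkClassB11 F N K k (B * ε₁) U} k V U →
          IsBackground (avOfRecord F N K) {U | InUkClassB11 F N K k ε₀ U} k V U' → InUkClassB11 F N K k ε₀ U ∧ OrbitRel k U U'))
    (hUk : ∀ (V : GaugeField (F.P K) k (SU N)) (δ : ℝ), 0 < δ → δ ≤ α₁ → B * δ ≤ a → PlaqSmall δ V →
      UkExists F N K k a V ∧ InUkClassB11 F N K k a (Uk F N K k a V))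
    (h11 : ∀ V : GaugeField (F.P K) k (SU N), PlaqSmall δ₁₁ V → UkExists F N K k a V ∧ UniqueUkOrbit F N K k a V)
    {W : GaugeField (F.P K) (k + 1) (SU N)} (hex : UkExists F N K (k + 1) a W)
    (hreg : ∀ U₁, IsBackground (avOfRecord F N K) (bgReg F N K (k + 1) a) (k + 1) W U₁ → U₁ ∈ bgReg F N K (k + 1) ρ) :
    IsBackground (avOfRecord F N K) (bgReg F N K k a) k (Averaging.iter (avOfRecord F N K) k (Uk F N K (k + 1) a W)) (Uk F N K (k + 1) a W) ∧
      UniqueUkOrbit F N K k a (Averaging.iter (avOfRecord F N K) k (Uk F N K (k + 1) a W)) := by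
  have h₀ : IsBackground (avOfRecord F N K) (bgReg F N K (k + 1) a) (k + 1) W (Uk F N K (k + 1) a W) := isBackground_Uk hex
  have hmem : Uk F N K (k + 1) a W ∈ bgReg F N K (k + 1) ρ := hreg _ h₀
  -- (53): the averaged datum is `2ρ∕L²`-plaquette-small
  have hV : PlaqSmall (2 * ρ / (F.L : ℝ) ^ 2) (Averaging.iter (avOfRecord F N K) k (Uk F N K (k + 1) a W)) :=
    plaqSmall_iter_of_mem_bgReg_succ K k hρ h53a h53b hmem
  have hL1 : (1 : ℝ) ≤ (F.L : ℝ) := by exact_mod_cast F.hL.2.le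
  have hL2 : (0 : ℝ) < (F.L : ℝ) ^ 2 := by positivity
  have hL2' : (1 : ℝ) ≤ (F.L : ℝ) ^ 2 := one_le_pow₀ hL1
  have hδpos : 0 < 2 * ρ / (F.L : ℝ) ^ 2 := by positivity
  have hδ₁₁ : 2 * ρ / (F.L : ℝ) ^ 2 ≤ δ₁₁ := by rw [div_le_iff₀ hL2]; exact hδ
  have hδα₁ : 2 * ρ / (F.L : ℝ) ^ 2 ≤ α₁ := by rw [div_le_iff₀ hL2]; exact hα₁
  have hBδ : B * (2 * ρ / (F.L : ℝ) ^ 2) ≤ a :=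
    calc B * (2 * ρ / (F.L : ℝ) ^ 2) = (2 * B * ρ) / (F.L : ℝ) ^ 2 := by ring
      _ ≤ 2 * B * ρ := div_le_self (by positivity) hL2'
      _ ≤ a := hBρ
  -- `h11` at the datum: solvability and (hQ)
  obtain ⟨hexV, huV⟩ := h11 _ (fun p => (hV p).trans_le hδ₁₁)
  refine ⟨?_, huV⟩
  -- the level-`k` minimiser of record at the datum lies in `bgReg_{k+1}(a)` by the (8)→(9) transfer
  have h₁ : IsBackground (avOfRecord F N K) (bgReg F N K k a) k (Averaging.iter (avOfRecord F N K) k (Uk F N K (k + 1) a W))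
      (Uk F N K k a (Averaging.iter (avOfRecord F N K) k (Uk F N K (k + 1) a W))) := isBackground_Uk hexV
  have h8 : PlaqSmall (B * (2 * ρ / (F.L : ℝ) ^ 2) * (F.P K).eta k ^ 2) (Uk F N K k a (Averaging.iter (avOfRecord F N K) k (Uk F N K (k + 1) a W))) :=
    plaqSmall_Uk_of_thm1_objects hT1 hUk haα hδpos hδα₁ hBδ hV
  have hmem₁ : Uk F N K k a (Averaging.iter (avOfRecord F N K) k (Uk F N K (k + 1) a W)) ∈ bgReg F N K (k + 1) a := by
    rw [mem_bgReg_iff]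
    intro p
    refine (h8 p).trans_le ?_
    rw [eta_succ_sq]
    calc B * (2 * ρ / (F.L : ℝ) ^ 2) * (F.P K).eta k ^ 2 = (2 * B * ρ) * ((F.P K).eta k ^ 2 / (F.L : ℝ) ^ 2) := by ring
      _ ≤ a * ((F.P K).eta k ^ 2 / (F.L : ℝ) ^ 2) := mul_le_mul_of_nonneg_right hBρ (by positivity)
      _ = a * ((F.P K).eta k ^ 2 / (F.L : ℝ) ^ 2) := rfl
  -- order theory, uniqueness-free
  exact isBackground_restrict_of_minimiser_mem (i := k) (n := 1) h₀ h₁ (bgReg_succ_subset ha.le K k) hmem₁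

/-- **A6 — THE `ρ`-NUMERICS ARE AN INHABITED RANGE**: for every `a, δ₁₁, α₁ > 0` and `B ≥ 0` some `ρ > 0` satisfies the (53) pair, `2ρ ≤ δ₁₁L²`, `2ρ ≤ α₁L²` and `2Bρ ≤ a` (all five are
upper bounds on `ρ`).  So §2's numerics do not empty the door. [cite: Balaban1985Averaging, Prop. 2 (52)–(53) p.26 (bookkeeping); Balaban1985Variational, Thm 1 p.279 (bookkeeping)] -/
theorem slotNumerics_inhabited {a δ₁₁ α₁ B : ℝ} (ha : 0 < a) (hδ : 0 < δ₁₁) (hα : 0 < α₁) (hB : 0 ≤ B) :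
    ∃ ρ : ℝ, 0 < ρ ∧ 143 * 256 * ρ ≤ 1 / 3 ∧ 2 * ρ ≤ 2 * deltaSU (Fin N) / (8 * (F.L : ℝ)) ^ 2 ∧
      2 * ρ ≤ δ₁₁ * (F.L : ℝ) ^ 2 ∧ 2 * ρ ≤ α₁ * (F.L : ℝ) ^ 2 ∧ 2 * B * ρ ≤ a := by
  haveI : Nonempty (Fin N) := ⟨0⟩
  have hL1 : (1 : ℝ) ≤ (F.L : ℝ) := by exact_mod_cast F.hL.2.le
  have hL2 : (1 : ℝ) ≤ (F.L : ℝ) ^ 2 := one_le_pow₀ hL1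
  have hdS : 0 < deltaSU (Fin N) := deltaSU_pos
  obtain ⟨c, hc⟩ : ∃ c : ℝ, c = deltaSU (Fin N) / (8 * (F.L : ℝ)) ^ 2 := ⟨_, rfl⟩
  have hcpos : 0 < c := by rw [hc]; positivity
  obtain ⟨ρ, hρ⟩ : ∃ ρ : ℝ, ρ = min (min (1 / (3 * (143 * 256))) c) (min (min (δ₁₁ / 2) (α₁ / 2)) (a / (2 * B + 2))) := ⟨_, rfl⟩
  have hden : 0 < 2 * B + 2 := by positivity
  have h1 : ρ ≤ 1 / (3 * (143 * 256)) := hρ ▸ (min_le_left _ _).trans (min_le_left _ _)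
  have h2 : ρ ≤ c := hρ ▸ (min_le_left _ _).trans (min_le_right _ _)
  have h3 : ρ ≤ δ₁₁ / 2 := hρ ▸ (min_le_right _ _).trans ((min_le_left _ _).trans (min_le_left _ _))
  have h4 : ρ ≤ α₁ / 2 := hρ ▸ (min_le_right _ _).trans ((min_le_left _ _).trans (min_le_right _ _))
  have h5 : ρ ≤ a / (2 * B + 2) := hρ ▸ (min_le_right _ _).trans (min_le_right _ _)
  have hρpos : 0 < ρ := by
    rw [hρ]
    exact lt_min (lt_min (by positivity) hcpos) (lt_min (lt_min (by positivity) (by positivity)) (by positivity))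
  refine ⟨ρ, hρpos, ?_, ?_, ?_, ?_, ?_⟩
  · calc 143 * 256 * ρ ≤ 143 * 256 * (1 / (3 * (143 * 256))) := by gcongr
      _ = 1 / 3 := by norm_num
  · rw [mul_div_assoc, ← hc]
    linarith
  · have h := mul_le_mul_of_nonneg_left hL2 hδ.le
    linarith
  · have h := mul_le_mul_of_nonneg_left hL2 hα.le
    linarith
  · calc 2 * B * ρ ≤ 2 * B * (a / (2 * B + 2)) := mul_le_mul_of_nonneg_left h5 (by positivity)
      _ ≤ (2 * B + 2) * (a / (2 * B + 2)) := mul_le_mul_of_nonneg_right (by linarith) (by positivity)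
      _ = a := mul_div_cancel₀ a hden.ne'

end Rows

/-! ## §3  The door re-issued: box at ONE radius + the three standard [B11] slots + §F rows + continuity + selector ⟹ 2′ BY NAME -/

section Door

variable (F : T4Family)

/-- ★★ **THE DOOR «2′ ⟸ box at ONE fixed radius ā», [15]-ROWS AT ā IN N07's STANDARD SLOT CURRENCY.**  Door level: `0 < ā ≤ α₀`, `0 ≤ B`; `hT1` = Theorem 1 AT OBJECTS at every member `(K, k)`
(ceilings `α₀ α₁`, constant `B`; dag-n07-a's `objects_of_thm1Printed` body VERBATIM); `hUk` = ₈a's rows at radius `ā`; `h11` = level-wise existence ∧ uniqueness of the radius-`ā` minimal orbit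
on `PlaqSmall δ₁₁` — the SAME three slots N09's doors display.  Per text radius `a₀ > 0` carrying the [15] antecedents, the producer gives `γ₀, ε₂₉, β′`, a regularity letter `ρ` with NUMERICS
(`0 < ρ`, the (53) pair, `2ρ ≤ δ₁₁L²`, `2ρ ≤ α₁L²`, `2Bρ ≤ ā`), a domain system `U` with: the box `−β′ ≤ β₁₃(F; ā, ε₂₉) ≤ β′` on `]0, γ₀]` at the zero member; `IsOpen (U K k)`; the
first-form sandwich (hsub)(hsup) at radius `ā`, regularity `ρ`; the Lipschitz-(8) collar row (hS); the continuity row (hT); the selector alternative (`a₀ ≤ ā ∧ ρ ≤ a₀`, or `ā ≤ a₀` with the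
(8)-row at radius `a₀`).  THEN `K0V23Defs.AbsBetaBoxAtThm1WitnessCCMGenGridGZBAt F` — via g19's `absBetaBoxGZBAt_of_boxAtRadius_of_firstFormRows`, its rows (hU1)(hR)(hQ) supplied by §2.
CONDITIONAL on every displayed row; NO β estimate; nothing of Bałaban's asserted. [cite: Balaban1987RG1, Thm 1 p.259, Thm 3 p.264, (1.20)–(1.22) p.264, (1.1)–(1.2) p.260, (2.9) p.266; Balaban1985Variational, Thm 1 (6),(8)–(10) p.279; Balaban1985Averaging, Prop. 2 (53) p.26 (bookkeeping)] -/
theorem absBetaBoxGZBAt_of_boxAtRadius_of_thm1Slots (ā δ₁₁ α₀ α₁ B : ℝ) (hā : 0 < ā) (hāα : ā ≤ α₀) (hB : 0 ≤ B)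
    (hT1 : ∀ (K k : ℕ) (ε₁ : ℝ), 0 < ε₁ → ε₁ ≤ α₁ → ∀ V : GaugeField (F.P K) k (Node00.SU 2), PlaqSmall ε₁ V →
      (∃ U : GaugeField (F.P K) 0 (Node00.SU 2), IsBackground (avOfRecord F 2 K) {U | InUkClassB11 F 2 K k (B * ε₁) U} k V U) ∧
      (∀ ε₀ : ℝ, B * ε₁ ≤ ε₀ → ε₀ ≤ α₀ → ∀ U U' : GaugeField (F.P K) 0 (Node00.SU 2),
          IsBackground (avOfRecord F 2 K) {U | InUkClassB11 F 2 K k (B * ε₁) U} k V U →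
          IsBackground (avOfRecord F 2 K) {U | InUkClassB11 F 2 K k ε₀ U} k V U' → InUkClassB11 F 2 K k ε₀ U ∧ OrbitRel k U U'))
    (hUk : ∀ (K k : ℕ) (V : GaugeField (F.P K) k (Node00.SU 2)) (δ : ℝ), 0 < δ → δ ≤ α₁ → B * δ ≤ ā → PlaqSmall δ V →
      UkExists F 2 K k ā V ∧ InUkClassB11 F 2 K k ā (Uk F 2 K k ā V))
    (h11 : ∀ (K k : ℕ) (V : GaugeField (F.P K) k (Node00.SU 2)), PlaqSmall δ₁₁ V → UkExists F 2 K k ā V ∧ UniqueUkOrbit F 2 K k ā V)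
    (h : ∀ a₀ : ℝ, 0 < a₀ →
      (∃ (j c c₀ c₁ : ℕ) (B₃ B₃' a₁ : ℝ), c ≤ F.L ^ j ∧ c₀ ≤ j + 1 ∧ c₁ ≤ j ∧ 2 * (F.L : ℝ) ^ 2 ≤ B₃ ∧ 0 < B₃' ∧ 0 < a₁ ∧
        VariationalThm1RegSepCoP7MGB F 2
          (fun ν M g K k _s => c ≤ ν.M₁ ∧ k + c₀ ≤ F.m + K ∧ F.L ^ c₁ ∣ M ∧
            ∀ i, 1 ≤ i → i ≤ k → dCubeSide (F.P K).L M (RkOfRecord (F.P K).L ν.r (g i)) i ∣ (F.P K).sitesPerDir 0) (lamDatum F) (dataSmall7LamTopOf F 2) B₃ a₀ a₁ ∧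
        Gauge9RegSepTopStepGB F 2 (fun ν K Ω => suppDomOfRecord F ν K Ω) (F.L ^ j)
          (fun ν M g K k _s => c ≤ ν.M₁ ∧ k + c₀ ≤ F.m + K ∧ F.L ^ c₁ ∣ M ∧
            ∀ i, 1 ≤ i → i ≤ k → dCubeSide (F.P K).L M (RkOfRecord (F.P K).L ν.r (g i)) i ∣ (F.P K).sitesPerDir 0) (lamDatum F) (dataSmall7LamTopOf F 2) B₃ B₃' a₀ a₁) →
      ∃ (γ₀ ε₂₉ β' ρ : ℝ) (U : (K k : ℕ) → Set (GaugeField (F.P K) k (Node00.SU 2))),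
        0 < γ₀ ∧ 0 < ε₂₉ ∧ 0 < ρ ∧ 143 * 256 * ρ ≤ 1 / 3 ∧ 2 * ρ ≤ 2 * deltaSU (Fin 2) / (8 * (F.L : ℝ)) ^ 2 ∧
        2 * ρ ≤ δ₁₁ * (F.L : ℝ) ^ 2 ∧ 2 * ρ ≤ α₁ * (F.L : ℝ) ^ 2 ∧ 2 * B * ρ ≤ ā ∧
        BetaLowerH (-β') γ₀ (betaOfRecord₁₃ F 2 (theta13OfThm1CCMWZB F 2 0 (1 / 2) ā 0 ε₂₉ 0 0 ā 0 (fun _ _ => 0) (fun _ _ => 0))) ∧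
        BetaUpperH β' γ₀ (betaOfRecord₁₃ F 2 (theta13OfThm1CCMWZB F 2 0 (1 / 2) ā 0 ε₂₉ 0 0 ā 0 (fun _ _ => 0) (fun _ _ => 0))) ∧
        (∀ K k, IsOpen (U K k)) ∧
        (∀ K k V, V ∈ U K k → UkExists F 2 K k ā V ∧ ∀ U₁, IsBackground (avOfRecord F 2 K) (bgReg F 2 K k ā) k V U₁ → U₁ ∈ bgReg F 2 K k ρ) ∧
        (∀ K k V, UkExists F 2 K k ā V → (∀ U₁, IsBackground (avOfRecord F 2 K) (bgReg F 2 K k ā) k V U₁ → U₁ ∈ bgReg F 2 K k ρ) → V ∈ U K k) ∧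
        (∀ K k V, k < K → (avOfRecord F 2 K k).avg V ∈ U K (k + 1) → chiFix29OfRecord F 2 (numerics7OfThm1CCM F.L 0 0 0 0 ā 0) ε₂₉ K k V ≠ 0 →
          UkExists F 2 K k ā V ∧ ∀ U₁, IsBackground (avOfRecord F 2 K) (bgReg F 2 K k ā) k V U₁ → U₁ ∈ bgReg F 2 K k ρ) ∧
        (∀ K (g : ℕ → ℝ) k, k < K → U K (k + 1) ⊆ regSetOfRecord F 2 K k
          (integrand (chiFixed29 F 2 (numerics7OfThm1CCM F.L 0 0 0 0 ā 0) ε₂₉ K g k) (gfOfRecord F 2 K k) (g k)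
            (effActionHT F 2 (TcanOfRecord F 2) (chiFixed29 F 2 (numerics7OfThm1CCM F.L 0 0 0 0 ā 0) ε₂₉) K g k))) ∧
        ((a₀ ≤ ā ∧ ρ ≤ a₀) ∨
          (ā ≤ a₀ ∧ ∀ K k W, k < K → W ∈ U K (k + 1) →
            UkExists F 2 K (k + 1) a₀ W ∧ ∀ U₁, IsBackground (avOfRecord F 2 K) (bgReg F 2 K (k + 1) a₀) (k + 1) W U₁ → U₁ ∈ bgReg F 2 K (k + 1) ā))) :
    AbsBetaBoxAtThm1WitnessCCMGenGridGZBAt F := by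
  refine absBetaBoxGZBAt_of_boxAtRadius_of_firstFormRows F ā fun a₀ ha₀ hant => ?_
  obtain ⟨γ₀, ε₂₉, β', ρ, U, hγ₀, hε, hρ, h53a, h53b, hδ, hα₁, hBρ, hlo, hup, hUo, hsub, hsup, hS, hT, hsel⟩ := h a₀ ha₀ hant
  have hRQ : ∀ K k W, k < K → W ∈ U K (k + 1) →
      IsBackground (avOfRecord F 2 K) (bgReg F 2 K k ā) k (Averaging.iter (avOfRecord F 2 K) k (Uk F 2 K (k + 1) ā W)) (Uk F 2 K (k + 1) ā W) ∧
        UniqueUkOrbit F 2 K k ā (Averaging.iter (avOfRecord F 2 K) k (Uk F 2 K (k + 1) ā W)) := fun K k W _ hW =>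
    isBackground_restrict_and_uniqueUkOrbit_of_slots K k hā hāα hρ h53a h53b hδ hα₁ hB hBρ (hT1 K k) (hUk K k) (h11 K k)
      (hsub K (k + 1) W hW).1 (hsub K (k + 1) W hW).2
  exact ⟨γ₀, ε₂₉, β', ρ, U, hγ₀, hε, hρ.le, hlo, hup, hUo, fun K k => hsup K k 1 (one_mem_firstForm K k hā hρ).1 (one_mem_firstForm K k hā hρ).2, hsub, hsup,
    fun K k W hk hW => (hRQ K k W hk hW).1, fun K k W hk hW => (hRQ K k W hk hW).2, hS, hT, hsel⟩

end Door

end Summit.QuantumFields.YangMills.BalabanUVNodes.K0TwoPrimeOfFixedRadiusBoxThm1Slots
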